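import Summits.BirchSwinnertonDyer.BirchSwinnertonDyer.Theorems.WildThreeRankOneBSDpOfJetchevMaxOfLiterature
import Summits.BirchSwinnertonDyer.BirchSwinnertonDyer.Theorems.WildThreeRankOneBSDpOfHeegnerIndexCoprime
import Summits.BirchSwinnertonDyer.BirchSwinnertonDyer.Theses.KatoDescentPotSupersingular
import Literature.NumberTheory.EllipticCurves.BSDQuadraticDescentShaOddPartGeneralProofs
import HarnessLib

/-!
# INDEX-EXCESS on single-carrier (incl. TAM3FREE) data of W-ALL row 2·3@3: when the index excess is the twist's
# analytic Sha, BOTH sockets follow from named print + K9's LOWER half L₀ — the IMC side (STEP L) is idle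
# (route-free class theorem; cell `bsd-wall`, D-0131 (3) M-UTD, seat `bsd-wall-utd-p3` gen 3; `--supports
# stmt-BirchSwinnertonDyer-20760`, helper)

Third sequel of `WildThreeRankOneBSDpOfJetchevMaxOfLiterature.lean` (p570933). The JET-EXACT rows (`i3 = t3 + v₃c`) are
done there and in `…Sockets.lean` / `…LowerHalfTwist.lean`. HERE: the census's INDEX-EXCESS rows — `ord₃[E(K):ℤP] =
ord₃ ∏_ℓ c_ℓ + v₃(c) + e` with `e ≥ 1`, the excess being EXPLAINED by the twist (`ord₃ Ш_an(E^{d_K}) = 2e`; census g11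
Q1/Q1′: «excess = √#Ш_an(E^D)» on every TAM3FREE row of record) — on single-carrier data (`t3 = 0`, or one prime carries
the whole `3`-part). On such a datum:
* UPPER socket `ord₃ #Ш(E/K) + 2t + 2v₃c ≤ 2·ord₃ I` ⟸ J_max@3 ({(PT),(F1),(3.7)}, p570933 §1) + McCallum Cor. 5.6 (named; gen 1's
  receptacle `upper_of_globalDivisibility` — the certificate-case kernel of `…OfLiterature` §2 does not apply when `e ≥ 1`);
* LOWER socket `2·ord₃ I ≤ ord₃ #Ш(E/K) + 2t + 2v₃c`, i.e. `2e ≤ ord₃ #Ш(E/K)` — NOT from any main conjecture: from K9's crux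
  L₀ `WildLowerHalfRankZero` at the rank-zero O6 twist `Wd` (`ord₃ Ш_an(Wd) ≤ ord₃ #Ш(Wd)`), the datum `ord₃ Ш_an(Wd) = 2e`, and
  the odd-primary Sha comparison `#Ш(E/K)[3^∞] = #Ш(E)[3^∞]·#Ш(E^D)[3^∞]` (Dokchitser–Dokchitser 2010 Lemma 4.14, tree theorem
  `card_primaryComponent_sha_baseChange_quadratic_of_odd_of_finite`);
* then `BSD₃(E) ⟺ BSD₃(Wd)` (gen 0 §4 `bsdp_iff_partner_bsdp_of_exactIndexManin`) and `BSD₃(Wd)` ⟸ L₀ + Kato's Tamagawa-exact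
  upper bound on the tower (kmc g20 `missingUpperBoundAt_twist_of_towerSurj_of_katoTam`).

`bsdp_three_of_singleCarrier_indexExcess_of_literature_of_katoTam_of_wildLowerHalfRankZero` — {(PT), (F1), (3.7)} + McCallum
Cor. 5.6 + {GZ, Kolyvagin, GZK, modularity, GZ86 I.(7.3)} + Kato A161″ (all named) + L₀ (K9 crux 19195, hypothesis) + the two
arithmetic data (`hI`, `hShaAn`) ⟹ `BSDp W 3`. With `e = 0` it is `…LowerHalfTwist` plus one idle named fact.

PARTITION (census BLOCK-A-index T17, onto-W r1 residue at 3): the habitat inside the residue is the TAM3FREE INDEX-EXCESS rows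
(`t3 = 0`: 282 (+1) + 7 (+2)), the single-carrier-at-3 INDEX-EXCESS rows (73 (+1,q=p) + 1 (+2,q=p)) and the single-carrier part of
the `(+1,tam3)` 106 / `(+2,tam3)` 3 rows — on those, the Kolyvagin AND the IMC side are now print + K9's L₀ (the research input the
rank-zero twist needs ANYWAY) + per-class analytic data; research content left there: L₀ only. HONEST FRAMING: CONDITIONAL on the named
facts and on L₀ (open crux of route `KatoDescentPotSupersingular`); per datum; closes no item and no class; «beyond-print theorem»: NO.
BSD is not proved for any curve by this file. No definition, no named fact, no `sorry`.
References: [Jetchev2008] Thm. 1.4, Cor. 1.5; [McCallumLMS1991] Cor. 5.6; [DokchitserDokchitserAnnals2010] Lemma 4.14;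
[Kato2004Asterisque] Thm. 14.5 (3); [JetchevSkinnerWan2017] §7.4.1; [GrossZagier1986] I.(6.3), I.(7.3).
-/

noncomputable section

open scoped Classical

set_option linter.dupNamespace false
set_option autoImplicit false

namespace Summit.BirchSwinnertonDyer.BirchSwinnertonDyer.Theorems.SchneiderFree.Exact

open WeierstrassCurve NumberField IsDedekindDomain Field
  Literature.NumberTheory.EllipticCurves
  Literature.NumberTheory.EllipticCurves.ModularForms
  Literature.NumberTheory.EllipticCurves.Rank1Residual
  Literature.NumberTheory.EllipticCurves.Rank1Residual.Typed
  Literature.NumberTheory.EllipticCurves.KrizLi2019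
  Literature.NumberTheory.GaloisCohomology
  Summit.BirchSwinnertonDyer.Rank1Residual
  Summit.BirchSwinnertonDyer.Rank1Residual.Additive
  Summit.BirchSwinnertonDyer.Rank1Residual.X11b
  Summit.BirchSwinnertonDyer.Rank1Residual.X11b.Three
  Summit.BirchSwinnertonDyer.BirchSwinnertonDyer.Theorems.UniversalToricDescentWaldspurgerFlat
  Summit.BirchSwinnertonDyer.BirchSwinnertonDyer.Theses.KatoDescentPotSupersingular

/-- **Single-carrier INDEX-EXCESS rows: `BSD₃(E)` ⟸ named print + McCallum + Kato + K9's L₀ + (index excess = twist's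
analytic Sha).** For `E` (globally minimal `W`) on `ClassO6 W 3` with `r_an = 1`, `ρ_{E,3^n}` onto for every `n`, ONE Heegner datum
`(K, Dt, H, ι, P)` at level `N_E` (odd `d_K`, Heegner hypothesis, `L(E^{d_K},1) ≠ 0`, `P = y_K`), a globally minimal model `Wd` of
`E^{d_K}`, an excess `e` with `ord₃[E(K):ℤP] = ord₃ ∏_ℓ c_ℓ + v₃(c) + e` (`hI`) and `ord₃ Ш_an(Wd) = 2e` (`hShaAn`), and ONE prime
`q₀ ∣ N_E` carrying the `3`-part of `c·∏_ℓ c_ℓ` (`hcar`): (PT) ∀ `K`, (F1), (3.7), McCallum Cor. 5.6, Gross–Zagier, Kolyvagin, GZK,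
modularity, GZ86 I.(7.3), Kato A161″ (named, hypotheses) and K9's crux L₀ `WildLowerHalfRankZero` (hypothesis) give `BSDp W 3`.
Proof: upper socket by gen 1's `upper_of_globalDivisibility` fed with J_max (p570933 §1) on the single carrier; lower socket from L₀
at `Wd`, `hShaAn` and `#Ш(E/K)[3^∞] = #Ш(E)[3^∞]·#Ш(Wd)[3^∞]`; `BSDp W 3 ↔ BSDp Wd 3` (gen 0 §4); `BSDp Wd 3` from L₀ + Kato.
[cite: Jetchev2008, Thm. 1.4, Cor. 1.5 (arXiv:math/0703431 p. 3)] [cite: McCallumLMS1991, §5 Cor. 5.6 (p. 310)]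
[cite: DokchitserDokchitserAnnals2010, Lemma 4.14] [cite: Kato2004Asterisque, Thm. 14.5 (3) (p. 236)]
[cite: JetchevSkinnerWan2017, §7.4.1 (arXiv:1512.06894 p. 30)] -/
theorem bsdp_three_of_singleCarrier_indexExcess_of_literature_of_katoTam_of_wildLowerHalfRankZero
    (hPT : ∀ (K : Type) [Field K] [NumberField K], poitouTate_selmerStructure_duality_conj K)
    (hF1 : Gross1991_heegnerPoint_sub_ratTorsion_mem_E0)
    (h372 : GrossLMS1991.prop37_2_frobeniusCongruence)
    (hMcU : McCallum1991_padicValNat_card_sha_primary_add_le_of_globalDivisibility)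
    (hGZ : ∀ (N : ℕ) [NeZero N] (W : WeierstrassCurve ℚ) (K : Type) [Field K] [NumberField K],
      gross_zagier N W K)
    (hKo : ∀ (N : ℕ) [NeZero N] (W : WeierstrassCurve ℚ) (K : Type) [Field K] [NumberField K],
      kolyvagin N W K)
    (hGZK : rank_eq_analyticRank_of_analyticRank_le_one) (hmod : hasEntireLFunction_rat)
    (hGZ73 : GrossZagier1986_thm_I_7_3)
    (hKatoT : Kato2004.rankZero_padicValNat_sha_add_padicValNat_tamagawa_le_of_additive_potGood_of_imageContainsSL2)
    (hL0 : WildLowerHalfRankZero)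
    (W : WeierstrassCurve ℚ) [W.IsElliptic] [W.IsGloballyMinimal] [NeZero (W.conductorNorm ℤ)]
    (hO6 : ClassO6 W 3) (hρ : ∀ n : ℕ, W.HasSurjectiveModNGaloisRep (3 ^ n : ℕ)) (hr : W.analyticRank = 1)
    (K : Type) [Field K] [NumberField K]
    (Dt : ModularParametrizationData W (W.conductorNorm ℤ))
    (H : HeegnerDatum (W.conductorNorm ℤ) (NumberField.discr K)) (ι : K →+* ℂ)
    (P : (W.baseChange K).toAffine.Point) (Wd : WeierstrassCurve ℚ) [Wd.IsElliptic] [Wd.IsGloballyMinimal]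
    (hK : IsImaginaryQuadratic K) (hodd : Odd (NumberField.discr K))
    (hHH : SatisfiesHeegnerHypothesis (W.conductorNorm ℤ) K)
    (hLd : (W.quadraticTwist (NumberField.discr K : ℚ)).entireLFunction 1 ≠ 0)
    (hP : WeierstrassCurve.Affine.Point.map ι.toRatAlgHom P = heegnerPointComplex Dt H)
    (hC : ∃ C : VariableChange ℚ, C • W.quadraticTwist (NumberField.discr K : ℚ) = Wd)
    {e : ℕ} (hI : padicValNat 3 (AddSubgroup.zmultiples P).index =
      padicValNat 3 W.tamagawaProduct + padicValNat 3 Dt.c.natAbs + e)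
    (hShaAn : ∃ q : ℚ, shaAn Wd = (q : ℂ) ∧ padicValRat 3 q = 2 * e)
    {q₀ : ℕ} [Fact q₀.Prime] (hq₀ : q₀ ∣ W.conductorNorm ℤ)
    (hcar : padicValNat 3 W.tamagawaProduct + padicValNat 3 Dt.c.natAbs ≤
      padicValNat 3 ((W.baseChange ℚ_[q₀]).localTamagawaNumber ℤ_[q₀])) :
    BSDp W 3 := by
  haveI : Fact (3 : ℕ).Prime := ⟨by norm_num⟩
  have hsurj : W.HasSurjectiveModNGaloisRep 3 := by simpa using hρ 1
  have htow : AdditiveThree.TowerSurjThree W := fun n _ ↦ hρ n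
  have h3N : 3 ∣ W.conductorNorm ℤ :=
    (W.dvd_conductorNorm_iff_not_hasGoodReductionAtPrime 3).mpr (not_good_of_addv W 3 hO6.2.1)
  have h3 : NumberField.discr K ≠ -3 := by
    intro h
    exact (X11b.Three.not_dvd_discr_and_not_dvd_torsionOrder_of_heegner hK hHH (by decide) h3N).1
      (h ▸ ⟨-1, by norm_num⟩)
  have h4 : NumberField.discr K ≠ -4 := by
    intro h
    rw [h] at hodd
    exact (Int.not_odd_iff_even.mpr ⟨-2, by norm_num⟩) hodd
  have hw : ¬ 3 ∣ Units.torsionOrder K :=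
    (X11b.Three.not_dvd_discr_and_not_dvd_torsionOrder_of_heegner hK hHH (by decide) h3N).2
  -- the Heegner point is non-torsion (Gross–Zagier); `Ш(E/K)` finite (Kolyvagin)
  have hL0v : W.entireLFunction 1 = 0 := entireLFunction_one_eq_zero_of_analyticRank_eq_one hr
  obtain ⟨-, hderiv⟩ := leadingLCoeff_eq_deriv_of_analyticRank_eq_one hr
  have hLK : LDerivEK W K ≠ 0 := by
    rw [lDerivEK_eq_deriv_mul W K hmod hL0v]; exact mul_ne_zero hderiv hLd
  have hnt : ¬ IsOfFinAddOrder P :=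
    (lDerivEK_ne_zero_iff_not_isOfFinAddOrder W (W.conductorNorm ℤ) K (hGZ _ W K) hK hHH
      ⟨Dt, H, ι, hP⟩).mp hLK
  obtain ⟨-, hfinK⟩ := hKo (W.conductorNorm ℤ) W K hK hHH ⟨Dt, H, ι, hP⟩ hnt
  haveI : Finite (W.baseChange K).sha := hfinK
  -- UPPER socket: J_max on the single carrier (print) + McCallum Cor. 5.6
  have hup : Upper.IndexUpperBoundLeAt W 3 K P (padicValNat 3 Dt.c.natAbs) :=
    upper_of_globalDivisibility hKo hMcU W 3 (by decide) hρ K hK h3 h4 hHH Dt H ι P hP hnt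
      (globalDivisibility_of_jetchevMax_of_singleCarrier
        (fun q _ hq s' hs' n d hn hℓ ↦ jetchevMaxAtThree_of_literature hPT hF1 h372 W (W.conductorNorm ℤ) K Dt H
          ι P hO6 hsurj hr rfl hK hHH hLd hP hnt hodd h3 htow q hq s' hs' n d hn hℓ) hq₀ hcar)
  -- the twist: O6, rank zero, finite `Ш`; its halves (L₀ below, Kato above) and `BSDp Wd 3`
  obtain ⟨Cd, hCd⟩ := hC
  obtain ⟨hO6d, -⟩ := classO6_twist_of_heegner W hO6 K hK hHH hodd Wd Cd hCd
  have hD0 : (NumberField.discr K : ℚ) ≠ 0 := by exact_mod_cast NumberField.discr_ne_zero K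
  haveI : (W.quadraticTwist (NumberField.discr K : ℚ)).IsElliptic := W.isElliptic_quadraticTwist hD0
  have hLd1 : Wd.entireLFunction 1 ≠ 0 := by rw [← hCd, entireLFunction_smul]; exact hLd
  have hrd : Wd.analyticRank = 0 := analyticRank_eq_zero_of_entireLFunction_one_ne_zero Wd hLd1
  have hlowd : MissingLowerBoundAt Wd 3 := hL0 Wd hrd hO6d
  have hupd : MissingUpperBoundAt Wd 3 :=
    missingUpperBoundAt_twist_of_towerSurj_of_katoTam 3 (by decide) hKatoT hGZK hmod W hO6.2.1
      hO6.padicValRat_j_nonneg hρ rfl K hK hHH Wd ⟨Cd, hCd⟩ hLd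
  have hWdBSD : BSDp Wd 3 :=
    bsdp_of_missingPPartAt Wd 3 hGZK (by rw [hrd]; exact zero_le_one) (missingPPartAt_of_lower_of_upper Wd 3 hlowd hupd)
  -- LOWER socket: `2e ≤ ord₃ #Ш(Wd) ≤ ord₃ #Ш(E/K)` (L₀ + the datum + the odd-primary Sha comparison)
  obtain ⟨-, hfinW⟩ := hGZK W (by rw [hr])
  haveI : Finite W.sha := hfinW
  obtain ⟨-, hfinWd⟩ := hGZK Wd (by rw [hrd]; exact zero_le_one)
  haveI : Finite Wd.sha := hfinWd
  have h2e : (2 * e : ℤ) ≤ padicValNat 3 Wd.shaOrder := by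
    obtain ⟨q, hq, hv⟩ := hShaAn
    obtain ⟨q', hq', hle⟩ := hlowd
    have hqq : q' = q := by exact_mod_cast hq'.symm.trans hq
    rw [hqq, hv] at hle
    exact_mod_cast hle
  have hprod : Nat.card (AddCommGroup.primaryComponent (W.baseChange K).sha 3) =
      Nat.card (AddCommGroup.primaryComponent W.sha 3) * Nat.card (AddCommGroup.primaryComponent Wd.sha 3) :=
    card_primaryComponent_sha_baseChange_quadratic_of_odd_of_finite W K hK.1 Wd ⟨Cd, hCd⟩ (W.baseChange K)
      ⟨1, one_smul _ _⟩ 3 (by decide)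
  have hshaK : padicValNat 3 Wd.shaOrder ≤ padicValNat 3 (W.baseChange K).shaOrder := by
    rw [Koly.padicValNat_shaOrder_eq (W.baseChange K) 3, Koly.padicValNat_shaOrder_eq Wd 3, hprod,
      padicValNat.mul (Nat.card_pos.ne') (Nat.card_pos.ne')]
    exact Nat.le_add_left _ _
  have hlo : IndexLowerBoundLeAt W 3 K P (padicValNat 3 Dt.c.natAbs) := by
    unfold IndexLowerBoundLeAt; omega
  -- conclusion: the exact index at slack `v₃(c)` makes `BSD₃(E) ⟺ BSD₃(Wd)` (gen 0 §4)
  exact (bsdp_iff_partner_bsdp_of_exactIndexManin hGZ hKo hGZK hmod hGZ73 W 3 (W.conductorNorm ℤ) K Dt H ι P Wd hr rfl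
    h3N hK hodd hw hHH hLd hP ⟨Cd, hCd⟩ (by decide) hlo hup).mpr hWdBSD

end Summit.BirchSwinnertonDyer.BirchSwinnertonDyer.Theorems.SchneiderFree.Exact

end
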